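import Summits.CriticalPhenomena.CardyFormulaZ2.Theorems.CardyFlipRussoVoronoiHubFromSmirnovDefs
import Summits.CriticalPhenomena.CardyFormulaZ2.Theorems.CardyFlipRussoVoronoiHubFromSmirnovStubMeasurableCrossEventReduction
import Literature.Probability.LatticeModels.DelaunayGraph

/-!
# Stub `convex_voronoiCell` of line `moebius-exact-delaunay-dilation-ward`
# (crux `VoronoiHubFromSmirnov`, stmt-CriticalPhenomena-6433)

VORONOI CELLS ARE CONVEX.  For any set of sites `ω ⊆ ℂ` and any point `p ∈ ℂ`, the closed Voronoi
cell `Literature.Probability.LatticeModels.voronoiCell ω p = {x | ∀ q ∈ ω, dist x p ≤ dist x q}` is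
a convex subset of the real vector space `ℂ` (J.-D. Boissonnat, M. Yvinec, *Algorithmic Geometry*,
CUP 1998, §17.1: a Voronoi cell is an intersection of closed half-spaces).  This is the basic
Voronoi API used by the S3/S4 arguments of the line.

Proof.  The cell is the intersection over `q ∈ ω` of the bisector half-planes
`{x | dist x p ≤ dist x q}` (`cvc_voronoiCell_eq_iInter`), so `convex_iInter₂` reduces the claim to
the convexity of one bisector half-plane, which is the landed lemma `convex_setOf_dist_le_dist` of
the S0 reduction file `CardyFlipRussoVoronoiHubFromSmirnovStubMeasurableCrossEventReduction`
(squaring the two distances, `dist x p ≤ dist x q ↔ ⟪q − p, x⟫ ≤ (‖q‖² − ‖p‖²)/2` is a closed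
half-space of a real-linear functional, convex by `convex_halfSpace_le`).  The same argument proves
`Literature.Barriers.AtomisticToContinuum.convex_voronoiCell` for the Kepler cells in `ℝ³`.

No new definitions.
-/

noncomputable section

namespace Summit.CriticalPhenomena.CardyFormulaZ2.Cruxes.VoronoiHubFromSmirnov.MoebiusExactDelaunayDilationWard

/-- **A Voronoi cell is the intersection of the bisector half-planes** of its site `p` against
every site `q ∈ ω`: `voronoiCell ω p = ⋂ q ∈ ω, {x | dist x p ≤ dist x q}` (unfolding of the
definition). [folklore] -/
theorem cvc_voronoiCell_eq_iInter (ω : Set ℂ) (p : ℂ) :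
    Literature.Probability.LatticeModels.voronoiCell ω p =
      ⋂ q ∈ ω, {x : ℂ | dist x p ≤ dist x q} := by
  ext x
  simp only [Literature.Probability.LatticeModels.mem_voronoiCell_iff, Set.mem_iInter,
    Set.mem_setOf_eq]

/-- **Voronoi cells are convex.** For every set of sites `ω ⊆ ℂ` and every `p ∈ ℂ`, the closed
Voronoi cell `voronoiCell ω p = {x | ∀ q ∈ ω, dist x p ≤ dist x q}` is convex: it is the
intersection over `q ∈ ω` of the convex bisector half-planes `{x | dist x p ≤ dist x q}`
(`cvc_voronoiCell_eq_iInter`, `convex_setOf_dist_le_dist`, `convex_iInter₂`); Boissonnat–Yvinec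
1998, §17.1. [folklore] -/
theorem convex_voronoiCell : ∀ (ω : Set ℂ) (p : ℂ), Convex ℝ (Literature.Probability.LatticeModels.voronoiCell ω p) := by
  intro ω p
  rw [cvc_voronoiCell_eq_iInter]
  exact convex_iInter₂ fun q _ => convex_setOf_dist_le_dist p q

end Summit.CriticalPhenomena.CardyFormulaZ2.Cruxes.VoronoiHubFromSmirnov.MoebiusExactDelaunayDilationWard
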